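/-
Copyright: harness tree, Literature layer (sorry-free). b2b-lace enum1-g51 (ENUMERATION SHARD A gen 51),
node KU-SEP-SEED-K1: composition of the twisted SEEDCERT soundness theorem with the row truncation.
-/
import Literature.Probability.FitznerVanDerHofstad2017.SrwTwistSeedCertSound
import Literature.Probability.FitznerVanDerHofstad2017.SrwTwistTruncationSeeds
import HarnessLib

/-!
# Twisted SEEDCERT: the certified bracket of the twisted axis seed

Composition of `TwCert.soundT` (`SrwTwistSeedCertSound`: a passing certificate brackets the literal
finite-row object `R_{n+1} = (n!)⁻¹ (∫_0^∞ τ^n e^{-τ} Re (Σ_{j≤J} ε_j I_{jm}(τ/D) c_j)^D dτ)/(2π)^D`,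
`c_j = 2π i^j Q_j/qden`) with the row-truncation / coefficient-rounding estimate
`abs_srwTwist_sub_rowObj_le` (`SrwTwistTruncationSeeds`: `|Tw_{n+1}(m e_i; β) - R_{n+1}| ≤ E`, `E` an explicit
nonnegative combination of plain seeds and Bessel tails): for every certificate `c` with `c.checkT D = true`,
every `n ≤ 3` with `2(n+1)+1 ≤ D`, every axis `i`, every twist parameter `β` and every ball parameter `M ≤ m`,

  `lo (n+1) - E ≤ srwTwist D (n+1) 1 (m e_i) β ≤ hi (n+1) + E`,   `E = TwCert.truncErrT c D n β M`.

Generic in the dimension; number-free; no instance in this module.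
[cite: FitznerVanDerHofstad2016NoBLE, §5.1.1 (5.2)–(5.5) pp. 1089–1090]
-/

set_option Elab.async false

namespace Literature.Probability.FitznerVanDerHofstad2017.SeedCert

open Real MeasureTheory Set Finset
open Literature.Probability.LatticeModels (besselI)
open Literature.Analysis.FunctionSpaces (besselJ)
open scoped Nat

namespace TwCert

variable (c : TwCert) (D : ℕ)

/-- The row-truncation + coefficient-rounding error of `abs_srwTwist_sub_rowObj_le` for the certificate's
row (`J = c.J`, `m = c.m`, `c' = c.cT`) at twist parameter `β`, seed index `n+1` and ball parameter `M`:
`Σ_{k<D} C(D,k+1) (2δ_J(β/D))^{k+1} I_{n+1,0}((J+1)M·(e_0+…+e_k)) + ((α'+η)^D - α'^D)/(2π)^D · I_{n+1,0}(0)`,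
`δ_J(y) = Σ_{l≥0} |J_{l+J+1}(y)|`, `α' = Σ_j ε_j ‖c_j‖`, `η = Σ_j ε_j ‖2π i^j J_j(β/D) - c_j‖`.
[cite: FitznerVanDerHofstad2016NoBLE, §5.1.1 (5.2)–(5.5) pp. 1089–1090] -/
noncomputable def truncErrT (n : ℕ) (β : ℝ) (M : ℕ) : ℝ :=
  (∑ k ∈ Finset.range D, (D.choose (k + 1) : ℝ)
      * (2 * ∑' l : ℕ, |besselJ (l + c.J + 1) (β / D)|) ^ (k + 1)
      * srwI D (n + 1) 0
          (fun μ : Fin D => if (μ : ℕ) < k + 1 then ((((c.J + 1) * M : ℕ)) : ℤ) else 0))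
    + (((∑ j ∈ Finset.range (c.J + 1), (if j = 0 then (1 : ℝ) else 2) * ‖c.cT j‖)
        + ∑ j ∈ Finset.range (c.J + 1), (if j = 0 then (1 : ℝ) else 2)
            * ‖2 * π * Complex.I ^ j * (besselJ j (β / D) : ℂ) - c.cT j‖) ^ D
      - (∑ j ∈ Finset.range (c.J + 1), (if j = 0 then (1 : ℝ) else 2) * ‖c.cT j‖) ^ D) / (2 * π) ^ D
    * srwI D (n + 1) 0 (fun _ : Fin D => 0)

/-- **Certified two-sided bracket of the twisted axis seed.** If the Boolean certificate check
`c.checkT D` passes, then for every `n ≤ 3` with `2(n+1)+1 ≤ D`, every axis `i : Fin D`, every `β : ℝ` and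
every `M ≤ c.m`:
`lo (n+1) - truncErrT ≤ srwTwist D (n+1) 1 (c.m · e_i) β ≤ hi (n+1) + truncErrT`
(`TwCert.soundT` composed with `abs_srwTwist_sub_rowObj_le` at `c' = c.cT`, `m = c.m`, `J = c.J`).
[cite: FitznerVanDerHofstad2016NoBLE, §5.1.1 (5.2)–(5.5) pp. 1089–1090] -/
theorem srwTwist_mem_of_checkT (h : c.checkT D = true) (n : ℕ) (hn : n ≤ 3)
    (hd : 2 * (n + 1) + 1 ≤ D) (i : Fin D) (β : ℝ) (M : ℕ) (hM : M ≤ c.m) :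
    ((c.lo (n + 1) : ℚ) : ℝ) - c.truncErrT D n β M
        ≤ srwTwist D (n + 1) (fun _ => 1) (Pi.single i (c.m : ℤ)) β ∧
    srwTwist D (n + 1) (fun _ => 1) (Pi.single i (c.m : ℤ)) β
        ≤ ((c.hi (n + 1) : ℚ) : ℝ) + c.truncErrT D n β M := by
  obtain ⟨h1, -, -, -⟩ := c.checkT_spec D h
  have hp := c.paramsT_of_paramsOKT D h1
  have hm : ((c.m : ℕ) : ℤ) ≠ 0 := by exact_mod_cast hp.m_pos.ne'
  have hM' : M ≤ ((c.m : ℕ) : ℤ).natAbs := by simpa using hM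
  have hs := c.soundT D h (n + 1) (by omega) (by omega)
  simp only [Nat.add_sub_cancel] at hs
  have ht := abs_srwTwist_sub_rowObj_le (d := D) n hd i hm β c.J M hM' c.cT
  rw [abs_sub_le_iff] at ht
  obtain ⟨ht1, ht2⟩ := ht
  obtain ⟨hs1, hs2⟩ := hs
  simp only [truncErrT]
  constructor <;> linarith

/-- The four-conjunct form of `srwTwist_mem_of_checkT` (the shape a kernel-decided instance supplies).
[cite: FitznerVanDerHofstad2016NoBLE, §5.1.1 (5.2)–(5.5) pp. 1089–1090] -/
theorem srwTwist_mem_of_parts (h1 : c.paramsOKT D = true) (h2 : c.finalCheckT D = true)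
    (h3 : c.poissonCheckT D = true) (h4 : c.tailCheckT D = true) (n : ℕ) (hn : n ≤ 3)
    (hd : 2 * (n + 1) + 1 ≤ D) (i : Fin D) (β : ℝ) (M : ℕ) (hM : M ≤ c.m) :
    ((c.lo (n + 1) : ℚ) : ℝ) - c.truncErrT D n β M
        ≤ srwTwist D (n + 1) (fun _ => 1) (Pi.single i (c.m : ℤ)) β ∧
    srwTwist D (n + 1) (fun _ => 1) (Pi.single i (c.m : ℤ)) β
        ≤ ((c.hi (n + 1) : ℚ) : ℝ) + c.truncErrT D n β M :=
  c.srwTwist_mem_of_checkT D (c.checkT_intro D h1 h2 h3 h4) n hn hd i β M hM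

/-- `truncErrT` is nonnegative (so the bracket is never vacuous by sign).
[cite: FitznerVanDerHofstad2016NoBLE, §5.1.1 (5.2)–(5.5) pp. 1089–1090] -/
theorem truncErrT_nonneg (h : c.checkT D = true) (n : ℕ)
    (hd : 2 * (n + 1) + 1 ≤ D) (i : Fin D) (β : ℝ) (M : ℕ) (hM : M ≤ c.m) :
    0 ≤ c.truncErrT D n β M := by
  obtain ⟨h1, -, -, -⟩ := c.checkT_spec D h
  have hp := c.paramsT_of_paramsOKT D h1
  have hm : ((c.m : ℕ) : ℤ) ≠ 0 := by exact_mod_cast hp.m_pos.ne'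
  have hM' : M ≤ ((c.m : ℕ) : ℤ).natAbs := by simpa using hM
  have ht := abs_srwTwist_sub_rowObj_le (d := D) n hd i hm β c.J M hM' c.cT
  have := (abs_nonneg _).trans ht
  simpa only [truncErrT] using this

end TwCert

end Literature.Probability.FitznerVanDerHofstad2017.SeedCert
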